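import Mathlib
import Summits.NavierStokesRegularity.NavierStokesRegularity.Theorems.EulerZoomLiouvillePowerGaugeEulerLiouvilleSelfSimilarShiftedSublinear
import Summits.NavierStokesRegularity.NavierStokesRegularity.Theorems.EulerZoomLiouvillePowerGaugeEulerLiouvilleSelfSimilarUniformlyContinuousLoc
import Literature.Analysis.FluidPDE.SpaceTimeRescaling
import HarnessLib

/-!
# The `A`-gauge of a SHIFTED exactly self-similar member in profile variables (large scales), and the shifted
# classical stratum for UNIFORMLY CONTINUOUS `C²` profiles
# (crux `EulerZoomLiouville.PowerGaugeEulerLiouville` = stmt-NavierStokesRegularity-19832, line `birth`, rung C1)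

Route `EulerZoomLiouville` (NavierStokesRegularity).  For a member exactly self-similar about the ORIGIN the `A`-gauge reads
`∫_{B_L}‖V‖² ≤ c L^{1−2ρ}` for EVERY `L > 0` (`profile_energy_growth_of_gaugeA`).  For a member exactly self-similar about a
SHIFTED space–time point `(T, x₀)`, `T ≥ 0` — `u(τ,x) = (T−τ)^{γ−1}V((T−τ)^{−γ}(x − x₀))` — the gauge (centred at the
PHYSICAL origin) sees the profile only at large profile scales; this file records the large-scale reading and its use:

* `Shifted.profile_energy_growth_of_gaugeA` — `0 < ρ ≤ ½`: there is `C < ∞` with `∫_{B_L}‖V‖² ≤ C L^{1−2ρ}` for all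
  `L ≥ 2` (slice `τ = −1`, radius `a = L(T+1)^γ + ‖x₀‖`, the space change of variables `y ↦ x₀ + (T+1)^γ y` of the tree's
  `setLIntegral_preimage_comp_space_affine`; `C = (T+1)^{2−2γ}(T+1)^{−3γ}((T+1)^γ + ‖x₀‖)^{1−2ρ} c`);
* `Shifted.growth_of_growth_two_le` — a continuous profile with that large-scale growth has `∫_{B_L}‖V‖² ≤ C' L^{1−2ρ}` for
  ALL `L > 0` (small balls by the local bound);
* `Shifted.selfSimilar_ae_eq_zero_of_uniformContinuousC2_profile` — MEMBER LEVEL (`0 < ρ ≤ ½`, the window): a member exactly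
  self-similar about any `(T, x₀)`, `T ≥ 0`, whose velocity profile is `C²` and UNIFORMLY CONTINUOUS is trivial
  (ns-typeII-p1 g8's spike estimate `Loc.sublinear_of_uniformContinuous_of_growth` ⇒ `V = o(|y|)` ⇒
  `Shifted.selfSimilar_ae_eq_zero_of_sublinearC2_profile`); in particular bounded-gradient profiles
  (`Shifted.selfSimilar_ae_eq_zero_of_boundedGradientC2_profile`).

WHAT THIS IS NOT: not NS, not E — a classical sub-stratum `--supports` stmt-19832; `C²` profiles of linear-or-faster sparse
growth that are not uniformly continuous, the weak class and the genuinely non-self-similar members stay OPEN.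
[folklore; ChaeShvydkoy2013 §1 (1.3) (the energy growth bound, setting)]
-/

noncomputable section

-- flat `Theorems/<Route><Decl>…` files of one crux share the namespace of the crux (tree convention: `Summit.<S>.<S>.…`)
set_option linter.dupNamespace false

open MeasureTheory Set Filter Topology Metric Function TopologicalSpace
open scoped ENNReal NNReal

namespace Summit.NavierStokesRegularity.NavierStokesRegularity.Theorems.PowerGaugeEulerLiouville

open Literature.Analysis Literature.Analysis.FunctionSpaces Literature.Analysis.FluidPDE

namespace Shifted

/-! ### The `A`-gauge of a shifted member, read at large profile scales -/

/-- **THE `A`-GAUGE OF A SHIFTED MEMBER IN PROFILE VARIABLES (large scales).**  If `u(τ, x) = (T−τ)^{γ−1} V((T−τ)^{−γ}(x − x₀))`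
for `τ < 0` (`γ = 1/(2+ρ)`, `0 < ρ ≤ ½`, `T ≥ 0`) and `a^{2ρ} A(a; 0) ≤ c` for all `a > 0`, then for some `C < ∞`:
`∫_{B_L} ‖V‖² ≤ C L^{1−2ρ}` for every `L ≥ 2`.  Proof: read the gauge on the slice `τ = −1` at radius
`a = L(T+1)^γ + ‖x₀‖` (`> 1`), whose physical ball contains the image of the profile ball `B_L` under `y ↦ x₀ + (T+1)^γ y`,
and change variables.  (For `(T, x₀) = (0,0)` the all-scales statement is `profile_energy_growth_of_gaugeA`.) [folklore] -/
theorem profile_energy_growth_of_gaugeA {ρ : ℝ} (hρ : 0 < ρ) (hρh : ρ ≤ 1 / 2) {T : ℝ} (hT : 0 ≤ T)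
    (x₀ : EuclideanSpace ℝ (Fin 3))
    {u : ℝ → EuclideanSpace ℝ (Fin 3) → EuclideanSpace ℝ (Fin 3)}
    {V : EuclideanSpace ℝ (Fin 3) → EuclideanSpace ℝ (Fin 3)} {c : ℝ≥0}
    (hu : ∀ τ : ℝ, τ < 0 → u τ = fun x => selfSimilarCollapse (1 / (2 + ρ)) T V τ (x - x₀))
    (hA : ∀ a : ℝ, 0 < a → ENNReal.ofReal (a ^ (2 * ρ)) *
      cknA a (0 : ℝ × EuclideanSpace ℝ (Fin 3)) u ≤ (c : ℝ≥0∞)) :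
    ∃ C : ℝ≥0∞, C ≠ ⊤ ∧ ∀ L : ℝ, 2 ≤ L →
      ∫⁻ y in ball (0 : EuclideanSpace ℝ (Fin 3)) L, ‖V y‖ₑ ^ 2 ≤ C * ENNReal.ofReal (L ^ (1 - 2 * ρ)) := by
  have _hρ := hρ
  set γ : ℝ := 1 / (2 + ρ) with hγ
  set s : ℝ := T + 1 with hs
  have hs0 : 0 < s := by rw [hs]; linarith
  set σ : ℝ := s ^ γ with hσ
  have hσ0 : 0 < σ := Real.rpow_pos_of_pos hs0 _
  have h12ρ : 0 ≤ 1 - 2 * ρ := by linarith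
  -- the constant
  set k : ℝ := s ^ (2 - 2 * γ) * (σ ^ 3)⁻¹ * (σ + ‖x₀‖) ^ (1 - 2 * ρ) with hk
  refine ⟨ENNReal.ofReal k * (c : ℝ≥0∞), ENNReal.mul_ne_top ENNReal.ofReal_ne_top ENNReal.coe_ne_top, fun L hL => ?_⟩
  have hL0 : 0 < L := by linarith
  -- the radius `a` and the slice `τ = −1`
  set a : ℝ := L * σ + ‖x₀‖ with ha
  have hσ1 : 1 ≤ σ := by
    rw [hσ]; exact Real.one_le_rpow (by rw [hs]; linarith) (by rw [hγ]; positivity)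
  have ha2 : 2 ≤ a := by
    have : 2 * 1 ≤ L * σ := mul_le_mul hL hσ1 zero_le_one hL0.le
    have := norm_nonneg x₀
    rw [ha]; linarith
  have ha0 : 0 < a := by linarith
  have hτ : (-1 : ℝ) ∈ Ioo ((0 : ℝ × EuclideanSpace ℝ (Fin 3)).1 - a ^ 2) (0 : ℝ × EuclideanSpace ℝ (Fin 3)).1 := by
    simp only [Prod.fst_zero, zero_sub, mem_Ioo]
    constructor <;> nlinarith
  have hslice : (ENNReal.ofReal a)⁻¹ * ∫⁻ x in ball (0 : EuclideanSpace ℝ (Fin 3)) a, ‖u (-1) x‖ₑ ^ 2 ≤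
      cknA a (0 : ℝ × EuclideanSpace ℝ (Fin 3)) u := by
    unfold cknA
    exact le_iSup₂ (f := fun t (_ : t ∈ Ioo ((0 : ℝ × EuclideanSpace ℝ (Fin 3)).1 - a ^ 2)
        (0 : ℝ × EuclideanSpace ℝ (Fin 3)).1) =>
        (ENNReal.ofReal a)⁻¹ * ∫⁻ x in ball (0 : ℝ × EuclideanSpace ℝ (Fin 3)).2 a, ‖u t x‖ₑ ^ 2) (-1) hτ
  set I : ℝ≥0∞ := ∫⁻ x in ball (0 : EuclideanSpace ℝ (Fin 3)) a, ‖u (-1) x‖ₑ ^ 2 with hI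
  have hgauge : ENNReal.ofReal (a ^ (2 * ρ)) * ((ENNReal.ofReal a)⁻¹ * I) ≤ (c : ℝ≥0∞) :=
    calc ENNReal.ofReal (a ^ (2 * ρ)) * ((ENNReal.ofReal a)⁻¹ * I)
        ≤ ENNReal.ofReal (a ^ (2 * ρ)) * cknA a (0 : ℝ × EuclideanSpace ℝ (Fin 3)) u := by gcongr
      _ ≤ (c : ℝ≥0∞) := hA a ha0
  -- `I ≤ a^{1−2ρ} c`
  have hKa : ENNReal.ofReal (a ^ (2 * ρ)) * (ENNReal.ofReal a)⁻¹ = ENNReal.ofReal (a ^ (2 * ρ - 1)) := by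
    rw [← ENNReal.ofReal_inv_of_pos ha0, ← ENNReal.ofReal_mul (by positivity), Real.rpow_sub_one ha0.ne',
      div_eq_mul_inv]
  have hIle : I ≤ ENNReal.ofReal (a ^ (1 - 2 * ρ)) * (c : ℝ≥0∞) := by
    have hunit : ENNReal.ofReal (a ^ (1 - 2 * ρ)) * ENNReal.ofReal (a ^ (2 * ρ - 1)) = 1 := by
      rw [← ENNReal.ofReal_mul (by positivity), ← Real.rpow_add ha0, show (1 - 2 * ρ) + (2 * ρ - 1) = 0 by ring,
        Real.rpow_zero, ENNReal.ofReal_one]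
    calc I = ENNReal.ofReal (a ^ (1 - 2 * ρ)) * (ENNReal.ofReal (a ^ (2 * ρ - 1)) * I) := by
          rw [← mul_assoc, hunit, one_mul]
      _ = ENNReal.ofReal (a ^ (1 - 2 * ρ)) * (ENNReal.ofReal (a ^ (2 * ρ)) * ((ENNReal.ofReal a)⁻¹ * I)) := by
          rw [← mul_assoc (ENNReal.ofReal (a ^ (2 * ρ))), hKa]
      _ ≤ ENNReal.ofReal (a ^ (1 - 2 * ρ)) * (c : ℝ≥0∞) := by gcongr
  -- ### change of variables `x = x₀ + σ y` on the slice `τ = −1`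
  have hval : ∀ y : EuclideanSpace ℝ (Fin 3),
      ‖u (-1) (x₀ + σ • y)‖ₑ ^ 2 = ENNReal.ofReal (s ^ (2 * (γ - 1))) * ‖V y‖ₑ ^ 2 := by
    intro y
    rw [hu (-1) (by norm_num)]
    simp only [selfSimilarCollapse_apply, add_sub_cancel_left, smul_smul]
    rw [show T - (-1 : ℝ) = s by rw [hs]; ring, hσ, ← Real.rpow_add hs0, show -γ + γ = 0 by ring, Real.rpow_zero,
      one_smul, enorm_smul, mul_pow, Real.enorm_eq_ofReal (Real.rpow_nonneg hs0.le _),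
      ← ENNReal.ofReal_pow (Real.rpow_nonneg hs0.le _), ← Real.rpow_natCast (s ^ (γ - 1)) 2,
      ← Real.rpow_mul hs0.le, show (γ - 1) * ((2 : ℕ) : ℝ) = 2 * (γ - 1) by push_cast; ring]
  have hpre : ball (0 : EuclideanSpace ℝ (Fin 3)) L ⊆
      (fun y : EuclideanSpace ℝ (Fin 3) => x₀ + σ • y) ⁻¹' ball (0 : EuclideanSpace ℝ (Fin 3)) a := by
    intro y hy
    rw [mem_ball_zero_iff] at hy
    rw [mem_preimage, mem_ball_zero_iff]
    calc ‖x₀ + σ • y‖ ≤ ‖x₀‖ + ‖σ • y‖ := norm_add_le _ _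
      _ = ‖x₀‖ + σ * ‖y‖ := by rw [norm_smul, Real.norm_of_nonneg hσ0.le]
      _ < ‖x₀‖ + σ * L := by gcongr
      _ = a := by rw [ha]; ring
  have hcov := setLIntegral_preimage_comp_space_affine hσ0 x₀
    (fun x : EuclideanSpace ℝ (Fin 3) => ‖u (-1) x‖ₑ ^ 2) (ball (0 : EuclideanSpace ℝ (Fin 3)) a)
  rw [finrank_euclideanSpace_fin] at hcov
  -- `s^{2(γ−1)} ∫_{B_L} ‖V‖² ≤ σ^{−3} I`
  have hmain : ENNReal.ofReal (s ^ (2 * (γ - 1))) * ∫⁻ y in ball (0 : EuclideanSpace ℝ (Fin 3)) L, ‖V y‖ₑ ^ 2 ≤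
      ENNReal.ofReal (σ ^ 3)⁻¹ * I := by
    rw [← hcov, ← lintegral_const_mul' _ _ ENNReal.ofReal_ne_top]
    calc ∫⁻ y in ball (0 : EuclideanSpace ℝ (Fin 3)) L, ENNReal.ofReal (s ^ (2 * (γ - 1))) * ‖V y‖ₑ ^ 2
        = ∫⁻ y in ball (0 : EuclideanSpace ℝ (Fin 3)) L, ‖u (-1) (x₀ + σ • y)‖ₑ ^ 2 :=
          lintegral_congr fun y => (hval y).symm
      _ ≤ ∫⁻ y in (fun y : EuclideanSpace ℝ (Fin 3) => x₀ + σ • y) ⁻¹' ball (0 : EuclideanSpace ℝ (Fin 3)) a,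
            ‖u (-1) (x₀ + σ • y)‖ₑ ^ 2 := lintegral_mono_set hpre
  -- ### assemble: `∫_{B_L}‖V‖² ≤ s^{2−2γ} σ^{−3} a^{1−2ρ} c ≤ k c L^{1−2ρ}`
  have haL : a ^ (1 - 2 * ρ) ≤ (σ + ‖x₀‖) ^ (1 - 2 * ρ) * L ^ (1 - 2 * ρ) := by
    rw [← Real.mul_rpow (by positivity) hL0.le]
    refine Real.rpow_le_rpow ha0.le ?_ h12ρ
    have : ‖x₀‖ ≤ ‖x₀‖ * L := le_mul_of_one_le_right (norm_nonneg _) (by linarith)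
    rw [ha]; nlinarith
  have hunit2 : ENNReal.ofReal (s ^ (2 - 2 * γ)) * ENNReal.ofReal (s ^ (2 * (γ - 1))) = 1 := by
    rw [← ENNReal.ofReal_mul (Real.rpow_nonneg hs0.le _), ← Real.rpow_add hs0,
      show (2 - 2 * γ) + 2 * (γ - 1) = 0 by ring, Real.rpow_zero, ENNReal.ofReal_one]
  calc ∫⁻ y in ball (0 : EuclideanSpace ℝ (Fin 3)) L, ‖V y‖ₑ ^ 2
      = ENNReal.ofReal (s ^ (2 - 2 * γ)) *
          (ENNReal.ofReal (s ^ (2 * (γ - 1))) * ∫⁻ y in ball (0 : EuclideanSpace ℝ (Fin 3)) L, ‖V y‖ₑ ^ 2) := by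
        rw [← mul_assoc, hunit2, one_mul]
    _ ≤ ENNReal.ofReal (s ^ (2 - 2 * γ)) * (ENNReal.ofReal (σ ^ 3)⁻¹ * I) := by gcongr
    _ ≤ ENNReal.ofReal (s ^ (2 - 2 * γ)) * (ENNReal.ofReal (σ ^ 3)⁻¹ *
          (ENNReal.ofReal (a ^ (1 - 2 * ρ)) * (c : ℝ≥0∞))) := by gcongr
    _ ≤ ENNReal.ofReal (s ^ (2 - 2 * γ)) * (ENNReal.ofReal (σ ^ 3)⁻¹ *
          (ENNReal.ofReal ((σ + ‖x₀‖) ^ (1 - 2 * ρ) * L ^ (1 - 2 * ρ)) * (c : ℝ≥0∞))) := by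
        gcongr
    _ = ENNReal.ofReal k * (c : ℝ≥0∞) * ENNReal.ofReal (L ^ (1 - 2 * ρ)) := by
        rw [hk, ENNReal.ofReal_mul (by positivity), ENNReal.ofReal_mul (by positivity),
          ENNReal.ofReal_mul (by positivity)]
        ring

/-- **From large scales to all scales.**  A continuous profile with `∫_{B_L}‖V‖² ≤ C L^θ` for `L ≥ 2` (`C < ∞`,
`θ ≤ 3`) satisfies `∫_{B_L}‖V‖² ≤ C' L^θ` for ALL `L > 0` with `C' = C + M² 2^{3−θ}|B₁| < ∞`, `M` a bound of `‖V‖` on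
the closed ball of radius `2` (small balls: `∫_{B_L}‖V‖² ≤ M² L³ |B₁| ≤ M² 2^{3−θ} |B₁| L^θ`). [folklore] -/
theorem growth_of_growth_two_le {V : EuclideanSpace ℝ (Fin 3) → EuclideanSpace ℝ (Fin 3)} (hVc : Continuous V)
    {θ : ℝ} (hθ3 : θ ≤ 3) {C : ℝ≥0∞} (hC : C ≠ ⊤)
    (hA : ∀ L : ℝ, 2 ≤ L → ∫⁻ y in ball (0 : EuclideanSpace ℝ (Fin 3)) L, ‖V y‖ₑ ^ 2 ≤ C * ENNReal.ofReal (L ^ θ)) :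
    ∃ C' : ℝ≥0∞, C' ≠ ⊤ ∧ ∀ L : ℝ, 0 < L →
      ∫⁻ y in ball (0 : EuclideanSpace ℝ (Fin 3)) L, ‖V y‖ₑ ^ 2 ≤ C' * ENNReal.ofReal (L ^ θ) := by
  -- a bound of `‖V‖` on the closed ball of radius `2`
  obtain ⟨M, hM⟩ := (isCompact_closedBall (0 : EuclideanSpace ℝ (Fin 3)) 2).exists_bound_of_continuousOn
    hVc.continuousOn
  have hM0 : 0 ≤ M := (norm_nonneg _).trans (hM 0 (mem_closedBall_self (by norm_num)))
  set v₁ : ℝ≥0∞ := volume (ball (0 : EuclideanSpace ℝ (Fin 3)) 1) with hv₁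
  have hv₁top : v₁ ≠ ⊤ := measure_ball_lt_top.ne
  set C₂ : ℝ≥0∞ := ENNReal.ofReal (M ^ 2 * (2 : ℝ) ^ (3 - θ)) * v₁ with hC₂
  refine ⟨C + C₂, ENNReal.add_ne_top.2 ⟨hC, ENNReal.mul_ne_top ENNReal.ofReal_ne_top hv₁top⟩, fun L hL => ?_⟩
  by_cases hL2 : 2 ≤ L
  · exact (hA L hL2).trans (by gcongr; exact le_self_add)
  · push Not at hL2
    -- small balls
    have hpt : ∀ y ∈ ball (0 : EuclideanSpace ℝ (Fin 3)) L, ‖V y‖ₑ ^ 2 ≤ ENNReal.ofReal (M ^ 2) := by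
      intro y hy
      have hy2 : y ∈ closedBall (0 : EuclideanSpace ℝ (Fin 3)) 2 :=
        mem_closedBall.2 ((mem_ball.1 hy).le.trans hL2.le)
      rw [← ofReal_norm, ← ENNReal.ofReal_pow (norm_nonneg _)]
      exact ENNReal.ofReal_le_ofReal (pow_le_pow_left₀ (norm_nonneg _) (hM y hy2) 2)
    have h1 : ∫⁻ y in ball (0 : EuclideanSpace ℝ (Fin 3)) L, ‖V y‖ₑ ^ 2 ≤
        ENNReal.ofReal (M ^ 2) * volume (ball (0 : EuclideanSpace ℝ (Fin 3)) L) := by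
      calc ∫⁻ y in ball (0 : EuclideanSpace ℝ (Fin 3)) L, ‖V y‖ₑ ^ 2
          ≤ ∫⁻ _ in ball (0 : EuclideanSpace ℝ (Fin 3)) L, ENNReal.ofReal (M ^ 2) :=
            setLIntegral_mono' measurableSet_ball hpt
        _ = ENNReal.ofReal (M ^ 2) * volume (ball (0 : EuclideanSpace ℝ (Fin 3)) L) := setLIntegral_const _ _
    rw [Measure.addHaar_ball_of_pos volume 0 hL, finrank_euclideanSpace_fin] at h1
    -- `L³ ≤ 2^{3−θ} L^θ` for `0 < L < 2`
    have hL3 : L ^ (3 : ℕ) ≤ (2 : ℝ) ^ (3 - θ) * L ^ θ := by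
      rw [← Real.rpow_natCast L 3, show ((3 : ℕ) : ℝ) = (3 - θ) + θ by push_cast; ring, Real.rpow_add hL]
      exact mul_le_mul_of_nonneg_right (Real.rpow_le_rpow hL.le hL2.le (by linarith)) (Real.rpow_nonneg hL.le _)
    calc ∫⁻ y in ball (0 : EuclideanSpace ℝ (Fin 3)) L, ‖V y‖ₑ ^ 2
        ≤ ENNReal.ofReal (M ^ 2) * (ENNReal.ofReal (L ^ (3 : ℕ)) * v₁) := h1
      _ ≤ ENNReal.ofReal (M ^ 2) * (ENNReal.ofReal ((2 : ℝ) ^ (3 - θ) * L ^ θ) * v₁) := by gcongr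
      _ = C₂ * ENNReal.ofReal (L ^ θ) := by
          rw [hC₂, ENNReal.ofReal_mul (by positivity), ENNReal.ofReal_mul (by positivity)]; ring
      _ ≤ (C + C₂) * ENNReal.ofReal (L ^ θ) := by gcongr; exact le_add_self

/-! ### Member level: uniformly continuous `C²` profiles, any blow-up point -/

/-- **THE SHIFTED CLASSICAL STRATUM FOR UNIFORMLY CONTINUOUS PROFILES, MEMBER LEVEL** (`0 < ρ ≤ ½`, the window).  Let
`(u, p)` be a distributional Euler pair on `(−∞,0) × ℝ³` with `a^{2ρ} A(a; 0) ≤ c` for all `a > 0`, exactly self-similar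
about `(T, x₀)`, `T ≥ 0`, with the class exponent and profile `(V, P)`.  If `V ∈ C²` is UNIFORMLY CONTINUOUS (it may be
unbounded), then `u = 0` a.e.: the large-scale `A`-growth `∫_{B_L}‖V‖² ≤ C L^{1−2ρ}` (`Shifted.profile_energy_growth_of_gaugeA`,
all `L` by `growth_of_growth_two_le`) and ns-typeII-p1 g8's spike estimate `Loc.sublinear_of_uniformContinuous_of_growth`
give `V(y) = o(|y|)`, and `Shifted.selfSimilar_ae_eq_zero_of_sublinearC2_profile` concludes.  For `(T, x₀) = (0,0)` this is
`Loc.selfSimilar_ae_eq_zero_of_uniformContinuousC2_profile`. [folklore] -/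
theorem selfSimilar_ae_eq_zero_of_uniformContinuousC2_profile {ρ : ℝ} (hρ : 0 < ρ) (hρh : ρ ≤ 1 / 2) {T : ℝ}
    (hT : 0 ≤ T) (x₀ : EuclideanSpace ℝ (Fin 3))
    {u : ℝ → EuclideanSpace ℝ (Fin 3) → EuclideanSpace ℝ (Fin 3)} {p : ℝ → EuclideanSpace ℝ (Fin 3) → ℝ} {c : ℝ≥0}
    (hsol : IsDistributionalNSSolutionOn (slab (EuclideanSpace ℝ (Fin 3)) (Iio 0) isOpen_Iio) 0 0 u p)
    (hA : ∀ a : ℝ, 0 < a → ENNReal.ofReal (a ^ (2 * ρ)) *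
      cknA a (0 : ℝ × EuclideanSpace ℝ (Fin 3)) u ≤ (c : ℝ≥0∞))
    {V : EuclideanSpace ℝ (Fin 3) → EuclideanSpace ℝ (Fin 3)} {P : EuclideanSpace ℝ (Fin 3) → ℝ}
    (hu : ∀ τ : ℝ, τ < 0 → u τ = fun x => selfSimilarCollapse (1 / (2 + ρ)) T V τ (x - x₀))
    (hp : ∀ τ : ℝ, τ < 0 → p τ = fun x => selfSimilarCollapsePressure (1 / (2 + ρ)) T P τ (x - x₀))
    (hV : ContDiff ℝ 2 V) (hUC : UniformContinuous V) :
    uncurry u =ᵐ[volume.restrict (Iio (0 : ℝ) ×ˢ (univ : Set (EuclideanSpace ℝ (Fin 3))))] 0 := by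
  obtain ⟨C, hC, hgrowth⟩ := profile_energy_growth_of_gaugeA hρ hρh hT x₀ hu hA
  obtain ⟨C', hC', hgrowth'⟩ := growth_of_growth_two_le hV.continuous (θ := 1 - 2 * ρ) (by linarith) hC hgrowth
  have hsub := Loc.sublinear_of_uniformContinuous_of_growth hUC hC' (θ := 1 - 2 * ρ) (by linarith) hgrowth'
  exact selfSimilar_ae_eq_zero_of_sublinearC2_profile hρ hT x₀ hsol hA hu hp hV hsub

/-- **In particular: bounded-gradient `C²` profiles, any blow-up point** (`0 < ρ ≤ ½`): if `V ∈ C²` with `‖DV‖ ≤ K` (`V`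
itself may be unbounded), the member vanishes (a bounded derivative makes `V` Lipschitz, hence uniformly continuous).
[folklore] -/
theorem selfSimilar_ae_eq_zero_of_boundedGradientC2_profile {ρ : ℝ} (hρ : 0 < ρ) (hρh : ρ ≤ 1 / 2) {T : ℝ}
    (hT : 0 ≤ T) (x₀ : EuclideanSpace ℝ (Fin 3))
    {u : ℝ → EuclideanSpace ℝ (Fin 3) → EuclideanSpace ℝ (Fin 3)} {p : ℝ → EuclideanSpace ℝ (Fin 3) → ℝ} {c : ℝ≥0}
    (hsol : IsDistributionalNSSolutionOn (slab (EuclideanSpace ℝ (Fin 3)) (Iio 0) isOpen_Iio) 0 0 u p)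
    (hA : ∀ a : ℝ, 0 < a → ENNReal.ofReal (a ^ (2 * ρ)) *
      cknA a (0 : ℝ × EuclideanSpace ℝ (Fin 3)) u ≤ (c : ℝ≥0∞))
    {V : EuclideanSpace ℝ (Fin 3) → EuclideanSpace ℝ (Fin 3)} {P : EuclideanSpace ℝ (Fin 3) → ℝ}
    (hu : ∀ τ : ℝ, τ < 0 → u τ = fun x => selfSimilarCollapse (1 / (2 + ρ)) T V τ (x - x₀))
    (hp : ∀ τ : ℝ, τ < 0 → p τ = fun x => selfSimilarCollapsePressure (1 / (2 + ρ)) T P τ (x - x₀))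
    (hV : ContDiff ℝ 2 V) {K : ℝ} (hK : ∀ y, ‖fderiv ℝ V y‖ ≤ K) :
    uncurry u =ᵐ[volume.restrict (Iio (0 : ℝ) ×ˢ (univ : Set (EuclideanSpace ℝ (Fin 3))))] 0 := by
  have hK0 : 0 ≤ K := (norm_nonneg _).trans (hK 0)
  have hlip : LipschitzWith ⟨K, hK0⟩ V :=
    lipschitzWith_of_nnnorm_fderiv_le (hV.differentiable (by norm_num)) fun y => by
      rw [← NNReal.coe_le_coe, coe_nnnorm]; exact hK y
  exact selfSimilar_ae_eq_zero_of_uniformContinuousC2_profile hρ hρh hT x₀ hsol hA hu hp hV hlip.uniformContinuous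

end Shifted

end Summit.NavierStokesRegularity.NavierStokesRegularity.Theorems.PowerGaugeEulerLiouville

end
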